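import Summits.BirchSwinnertonDyer.BirchSwinnertonDyer.Theorems.SignedLowerHalvesKobayashiMainConjectureSmallImageLambdaTransferCM
import Summits.BirchSwinnertonDyer.BirchSwinnertonDyer.Theorems.SignedLowerHalvesKobayashiLowerHalfLargeImageCongruencePlaces
import Summits.BirchSwinnertonDyer.BirchSwinnertonDyer.Theorems.SignedLowerHalvesKobayashiMainConjectureSmallImageCMTransferMuRecords12
import HarnessLib

/-!
# Route `SignedLowerHalves`, crux `KobayashiMainConjectureSmallImage` (item stmt-BirchSwinnertonDyer-19002):
# small-image congruence road («L4-λ») — RECORDS part 03: the pair `(413600l1, 3)`, BOTH signs, and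
# `BSD(E,3)` for it in analytic rank one (cell `bsd-ssimc`, seat `bsd-ssimc-k3-c4` gen 6; planner ruling
# D23-7; a `--supports stmt-BirchSwinnertonDyer-19002 --as helper` file; closes nothing about the crux)

PARTITION (cell bsd-ssimc): X7 (A7) × ONE item-4 window pair — `413600l1 @ 3` (`ρ̄_{E,3}` = 3Nn,
`r_an = 1`, `λ± = 3`: no tight Mazur–Tate row, so the rank-one squeeze (p450713) is void and until now
its signed main conjecture stood MODULO the Corpuz–Lei preprint binder, `…CMTransferMuRecords12.lean`)
— closes PER PAIR (Kobayashi's signed main conjecture for both signs from PUBLISHED facts + displayed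
certificates, and `BSD(E,3)` through Burungale–Kobayashi–Ota Cor. A.5 with its two displayed referee
flags); the crux `KobayashiMainConjectureSmallImage` stays OPEN; nothing booked; BSD is not proved by
any of this. THEOREMS ONLY.

## The record (shape `SmallImageCongruenceRoad.kobayashiMainConjecture_{neg_one,one}_of_cmPartner_of_mazurTate`)

Target `E = [0,0,0,−5900,−4528000]` (Cremona 413600l1, `N = 413600 = 2⁵·5²·11·47`); partner
`A = [0,0,0,−25,0] : y² = x³ − 25x` (Cremona 800a1, `N′ = 800 = 2⁵·5²`, CM by `ℤ[i]`, `3` inert,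
`r_an = 1`), `E[3] ≃ A[3]` by the KERNEL certificate `threeCongruent_of_dualHesseCertificate_unconditional`
(dual Hesse pencil of `A` at `(λ:μ) = (−80:1)`, `u = 1/120`, as in `…CMTransferMuRecords12.lean`).
CERTIFICATES (kit **j261781**, `--tag bsd`, engines B = b2b lit-g7 msengine (exact symbols) and T = iw-2
twisted `L`-values; evidence on the item; file of record HOME/bsd-ssimc-k3-c4/g6/): `E`: odd layer `θ_3`,
`(μ, λ) = (0, 9) = (0, deg ω_3^+ + 3)` — B AND T (`V = 9 < 18`, CERTIFIED); even layer `θ_2`, `(μ, λ) =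
(0, 5) = (0, deg ω_2^- + 3)` — B AND T (`V = 5 < 6`, CERTIFIED) (= b2b iw-2 `ss500k_pairs.tsv` λ± = 3,
`engT_layers.tsv` rows, independently); `A`: `θ_1`, `(0, 1)`, `θ_2`, `(0, 3)` — B, T (exact match with PARI
`msfromell`) and A (`ellpadiclambdamu = [[1,1],[0,0]]`). `Σ₀ = {2, 5, 11, 47}`, KERNEL-DECIDED by the place
toolkit (p465598): `δ_E = (0, 0, 0, 0)` (additive, additive, split `11 ≢ 1`, split `47 ≢ 1 (mod 3)`),
`δ_A = (0, 0, 1, 1)` (additive, additive, good `#Ã(𝔽_11) = 12`, good `#Ã(𝔽_47) = 48`, `11, 47 ≢ 1`, `s = 1`);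
bookkeeping `3 + 0 = 1 + 2` for both signs. Published inputs BY NAME (`h12 h41 h5 h3 h09 hKim hPR hmod
hPollack`; `hA5 hmod' hGZK` for `BSD(E,3)`); data binders as in part 01. NO `Surj`, NO preprint.

References: [Kobayashi2003] Conj. (p. 2), Thm. 1.2, 4.1; [BDKim2009] Cor. 2.13, 2.5, Prop. 2.6;
[PollackRubin2004] Thm. (p. 448); [Pollack2003] Def. 6.15, Prop. 6.9/6.10/6.18; [Fisher2012Hessian] §13;
[GreenbergVatsal2000] Prop. (2.4); [BurungaleKobayashiOta2023] Cor. A.5; [Cremona2006] Table 1 (413600l1, 800a1).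
-/

set_option autoImplicit false
set_option linter.dupNamespace false
noncomputable section

open scoped Classical MatrixGroups ModularForm BigOperators

open CongruenceSubgroup WeierstrassCurve NumberField IsDedekindDomain Rat.HeightOneSpectrum
  Literature.NumberTheory.EllipticCurves
  Literature.NumberTheory.EllipticCurves.ModularForms
  Literature.NumberTheory.EllipticCurves.Rank1Residual
  Literature.NumberTheory.EllipticCurves.Rank1Residual.Typed
  Literature.NumberTheory.EllipticCurves.Kobayashi2003 ZpExtension
  Literature.NumberTheory.EllipticCurves.GreenbergVatsal2000
  Literature.NumberTheory.EllipticCurves.BDKim2009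
  Literature.NumberTheory.EllipticCurves.Fisher2012
  Literature.NumberTheory.EllipticCurves.BurungaleKobayashiOta2024
  Literature.NumberTheory.EllipticCurves.Rank1Residual.X11RankOneCertificates
  Literature.NumberTheory.GaloisRepresentations
  Summit.BirchSwinnertonDyer.Rank1Residual.X1.MuLambda
  Summit.BirchSwinnertonDyer.Rank1Residual.Supersingular
  Summit.BirchSwinnertonDyer.Rank1Residual.X2.LocalDeltaCalculus
  Summit.BirchSwinnertonDyer.BirchSwinnertonDyer.Rank1Residual.IntModel
  Summit.BirchSwinnertonDyer.BirchSwinnertonDyer.Rank1Residual.X11RankOne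
  Summit.BirchSwinnertonDyer.Rank1Residual.X11b
  Summit.BirchSwinnertonDyer.BirchSwinnertonDyer.Theorems.CongruenceRoad

namespace Summit.BirchSwinnertonDyer.BirchSwinnertonDyer.Theorems.SmallImageCongruenceRoad

/-! ### §1 Kernel data of the pair -/

/-- `#Ã(𝔽_11) = 12` for the partner `800a1 = [0,0,0,−25,0]` (`a_11 = 0`; fast count). [cite: Cremona2006, Table 1 (Cremona label 800a1)] -/
theorem countPoints_800a1_11 : countPoints [0, 0, 0, -25, 0] 11 = (12 : ℕ) :=
  countPoints_eq_of_fast (by decide +kernel)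

/-- `#Ã(𝔽_47) = 48` for the partner `800a1 = [0,0,0,−25,0]` (`a_47 = 0`; fast count). [cite: Cremona2006, Table 1 (Cremona label 800a1)] -/
theorem countPoints_800a1_47 : countPoints [0, 0, 0, -25, 0] 47 = (48 : ℕ) :=
  countPoints_eq_of_fast (by decide +kernel)

/-- **The δ-bookkeeping of `(413600l1, 800a1)` at `3`, KERNEL-DECIDED**: with `Σ₀` the places over
`{2, 5, 11, 47}` (away from `3`, containing every bad place of both curves), `Σ_{Σ₀} δ_E = 0` and
`Σ_{Σ₀} δ_A = 2`. [cite: GreenbergVatsal2000, §2 Prop. (2.4) (p. 22)] [cite: SilvermanAEC2009, VII.5 Prop. 5.1]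
[cite: Cremona2006, Table 1 (Cremona labels 413600l1, 800a1)] -/
theorem places_413600l1_800a1 (W A : WeierstrassCurve ℚ) [W.IsElliptic] [W.IsGloballyMinimal]
    [A.IsElliptic] [A.IsGloballyMinimal]
    (hW : W = ⟨0, 0, 0, -5900, -4528000⟩) (hA : A = ⟨0, 0, 0, -25, 0⟩) :
    ∃ S₀ : Finset (HeightOneSpectrum (𝓞 ℚ)), (∀ v ∈ S₀, ((3 : ℕ) : 𝓞 ℚ) ∉ v.asIdeal) ∧
      (∀ v : HeightOneSpectrum (𝓞 ℚ), ¬ W.HasGoodReductionAt v → v ∈ S₀) ∧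
      (∀ v : HeightOneSpectrum (𝓞 ℚ), ¬ A.HasGoodReductionAt v → v ∈ S₀) ∧
      ∑ v ∈ S₀, delta W 3 v = 0 ∧ ∑ v ∈ S₀, delta A 3 v = 2 := by
  have hI : integralModelInt W = ⟨0, 0, 0, -5900, -4528000⟩ :=
    integralModelInt_eq_of_map_eq _ (by rw [hW]; ext <;> simp [WeierstrassCurve.map])
  have hI' : integralModelInt A = ⟨0, 0, 0, -25, 0⟩ :=
    integralModelInt_eq_of_map_eq _ (by rw [hA]; ext <;> simp [WeierstrassCurve.map])
  set v2 : HeightOneSpectrum (𝓞 ℚ) := (primesEquiv (R := 𝓞 ℚ)).symm ⟨2, Nat.prime_two⟩ with hv2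
  set v5 : HeightOneSpectrum (𝓞 ℚ) := (primesEquiv (R := 𝓞 ℚ)).symm ⟨5, by norm_num⟩ with hv5
  set v11 : HeightOneSpectrum (𝓞 ℚ) := (primesEquiv (R := 𝓞 ℚ)).symm ⟨11, by norm_num⟩ with hv11
  set v47 : HeightOneSpectrum (𝓞 ℚ) := (primesEquiv (R := 𝓞 ℚ)).symm ⟨47, by norm_num⟩ with hv47
  -- δ-terms of `E`: additive at 2, 5; split at 11 and at 47 (`11, 47 ≢ 1 (mod 3)`)
  have d2 : delta W 3 v2 = 0 :=
    delta_eq_zero_of_dvd_of_dvd hI 3 v2 (by rw [hv2, natGenerator_symm]; decide)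
      (by rw [hv2, natGenerator_symm]; decide)
  have d5 : delta W 3 v5 = 0 :=
    delta_eq_zero_of_dvd_of_dvd hI 3 v5 (by rw [hv5, natGenerator_symm]; decide)
      (by rw [hv5, natGenerator_symm]; decide)
  have d11 : delta W 3 v11 = 0 := by
    rw [delta_eq_of_split hI 3 v11 11 (by norm_num) (by rw [hv11, natGenerator_symm]) (by decide) (by decide)
      ⟨1, by decide +kernel⟩, sFactor_eq_of_eq_pow_mul (k := 0) (m := 40) (by norm_num) (by norm_num)]
    decide
  have d47 : delta W 3 v47 = 0 := by
    rw [delta_eq_of_split hI 3 v47 47 (by norm_num) (by rw [hv47, natGenerator_symm]) (by decide) (by decide)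
      ⟨9, by decide +kernel⟩, sFactor_eq_of_eq_pow_mul (k := 0) (m := 736) (by norm_num) (by norm_num)]
    decide
  -- δ-terms of `A`: additive at 2, 5; good at 11 (`#Ã = 12`) and 47 (`#Ã = 48`)
  have e2 : delta A 3 v2 = 0 :=
    delta_eq_zero_of_dvd_of_dvd hI' 3 v2 (by rw [hv2, natGenerator_symm]; decide)
      (by rw [hv2, natGenerator_symm]; decide)
  have e5 : delta A 3 v5 = 0 :=
    delta_eq_zero_of_dvd_of_dvd hI' 3 v5 (by rw [hv5, natGenerator_symm]; decide)
      (by rw [hv5, natGenerator_symm]; decide)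
  have e11 : delta A 3 v11 = 1 := by
    rw [delta_eq_of_good_of_dvd_count hI' 3 v11 11 (by norm_num) (by rw [hv11, natGenerator_symm]) (by norm_num)
      (by norm_num) rfl (by decide) countPoints_800a1_11 (by decide),
      sFactor_eq_of_eq_pow_mul (k := 0) (m := 40) (by norm_num) (by norm_num)]
    decide
  have e47 : delta A 3 v47 = 1 := by
    rw [delta_eq_of_good_of_dvd_count hI' 3 v47 47 (by norm_num) (by rw [hv47, natGenerator_symm]) (by norm_num)
      (by norm_num) rfl (by decide) countPoints_800a1_47 (by decide),
      sFactor_eq_of_eq_pow_mul (k := 0) (m := 736) (by norm_num) (by norm_num)]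
    decide
  have n1 : v2 ∉ ({v5, v11, v47} : Finset (HeightOneSpectrum (𝓞 ℚ))) := by
    simp only [Finset.mem_insert, Finset.mem_singleton, hv2, hv5, hv11, hv47, not_or]
    exact ⟨symm_ne_symm _ _ (by norm_num), symm_ne_symm _ _ (by norm_num), symm_ne_symm _ _ (by norm_num)⟩
  have n2 : v5 ∉ ({v11, v47} : Finset (HeightOneSpectrum (𝓞 ℚ))) := by
    simp only [Finset.mem_insert, Finset.mem_singleton, hv5, hv11, hv47, not_or]
    exact ⟨symm_ne_symm _ _ (by norm_num), symm_ne_symm _ _ (by norm_num)⟩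
  have n3 : v11 ∉ ({v47} : Finset (HeightOneSpectrum (𝓞 ℚ))) := by
    simp only [Finset.mem_singleton, hv11, hv47]
    exact symm_ne_symm _ _ (by norm_num)
  refine ⟨{v2, v5, v11, v47}, ?_, ?_, ?_, ?_, ?_⟩
  · intro v hv
    simp only [Finset.mem_insert, Finset.mem_singleton] at hv
    rcases hv with rfl | rfl | rfl | rfl
    · exact natCast_not_mem_symm (by norm_num) _ (by norm_num)
    · exact natCast_not_mem_symm (by norm_num) _ (by norm_num)
    · exact natCast_not_mem_symm (by norm_num) _ (by norm_num)
    · exact natCast_not_mem_symm (by norm_num) _ (by norm_num)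
  · -- `Σ₀ ⊇` bad places of `E`: `Δ(E) = −2¹²·5⁶·11³·47³`
    intro v hv
    by_contra hvS
    apply hv
    apply hasGoodReductionAt_of_not_dvd hI
    intro hdvd
    have hΔ : (⟨0, 0, 0, -5900, -4528000⟩ : WeierstrassCurve ℤ).Δ = -(2 ^ 12 * 5 ^ 6 * 11 ^ 3 * 47 ^ 3) := by
      decide
    rw [hΔ, dvd_neg] at hdvd
    have hpr := prime_natGenerator v
    have h' : natGenerator v ∣ 2 ^ 12 * 5 ^ 6 * 11 ^ 3 * 47 ^ 3 := by exact_mod_cast hdvd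
    have key : natGenerator v = 2 ∨ natGenerator v = 5 ∨ natGenerator v = 11 ∨ natGenerator v = 47 := by
      rcases (Nat.Prime.dvd_mul hpr).mp h' with h | h
      · rcases (Nat.Prime.dvd_mul hpr).mp h with h | h
        · rcases (Nat.Prime.dvd_mul hpr).mp h with h | h
          · exact Or.inl ((Nat.prime_dvd_prime_iff_eq hpr Nat.prime_two).mp (hpr.dvd_of_dvd_pow h))
          · exact Or.inr (Or.inl ((Nat.prime_dvd_prime_iff_eq hpr (by norm_num)).mp (hpr.dvd_of_dvd_pow h)))
        · exact Or.inr (Or.inr (Or.inl ((Nat.prime_dvd_prime_iff_eq hpr (by norm_num)).mp (hpr.dvd_of_dvd_pow h))))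
      · exact Or.inr (Or.inr (Or.inr ((Nat.prime_dvd_prime_iff_eq hpr (by norm_num)).mp (hpr.dvd_of_dvd_pow h))))
    apply hvS
    simp only [Finset.mem_insert, Finset.mem_singleton]
    rcases key with h | h | h | h
    · exact Or.inl (eq_symm_of_natGenerator_eq Nat.prime_two h)
    · exact Or.inr (Or.inl (eq_symm_of_natGenerator_eq (by norm_num) h))
    · exact Or.inr (Or.inr (Or.inl (eq_symm_of_natGenerator_eq (by norm_num) h)))
    · exact Or.inr (Or.inr (Or.inr (eq_symm_of_natGenerator_eq (by norm_num) h)))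
  · -- `Σ₀ ⊇` bad places of `A`: `Δ(A) = 2⁶·5⁶`
    intro v hv
    by_contra hvS
    apply hv
    apply hasGoodReductionAt_of_not_dvd hI'
    intro hdvd
    have hΔ : (⟨0, 0, 0, -25, 0⟩ : WeierstrassCurve ℤ).Δ = 2 ^ 6 * 5 ^ 6 := by decide
    rw [hΔ] at hdvd
    have hpr := prime_natGenerator v
    have h' : natGenerator v ∣ 2 ^ 6 * 5 ^ 6 := by exact_mod_cast hdvd
    have key : natGenerator v = 2 ∨ natGenerator v = 5 := by
      rcases (Nat.Prime.dvd_mul hpr).mp h' with h | h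
      · exact Or.inl ((Nat.prime_dvd_prime_iff_eq hpr Nat.prime_two).mp (hpr.dvd_of_dvd_pow h))
      · exact Or.inr ((Nat.prime_dvd_prime_iff_eq hpr (by norm_num)).mp (hpr.dvd_of_dvd_pow h))
    apply hvS
    simp only [Finset.mem_insert, Finset.mem_singleton]
    rcases key with h | h
    · exact Or.inl (eq_symm_of_natGenerator_eq Nat.prime_two h)
    · exact Or.inr (Or.inl (eq_symm_of_natGenerator_eq (by norm_num) h))
  · norm_num [Finset.sum_insert n1, Finset.sum_insert n2, Finset.sum_insert n3, Finset.sum_singleton, d2, d5,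
      d11, d47]
  · norm_num [Finset.sum_insert n1, Finset.sum_insert n2, Finset.sum_insert n3, Finset.sum_singleton, e2, e5,
      e11, e47]

/-! ### §2 The records: both signs, and `BSD(E,3)` in analytic rank one -/

/-- **`lam4_413600l1_3` — Kobayashi's main conjecture for `(413600l1, 3, ε)`, EITHER sign, AT THE PAIR by
the small-image congruence road (NO preprint, NO `Surj`, NO `BSD(E,3)` input, NO tight row).** Certificates
DISPLAYED as hypotheses: for `E` the odd row `θ_3` (`λ = 6 + 3`) if `ε = −1`, the even row `θ_2`
(`λ = 2 + 3`) if `ε = 1`; for the CM partner `A = 800a1` the rows `θ_1` (`λ = 0 + 1`) / `θ_2` (`λ = 2 + 1`)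
(kit j261781, engines B + T). The `3`-congruence and the δ-bookkeeping `3 + 0 = 1 + 2` are KERNEL-CHECKED.
PER PAIR; nothing booked; BSD is not proved by any of this.
[cite: Kobayashi2003, Conjecture (p. 2), Thm. 1.2 and Thm. 4.1] [cite: BDKim2009, Cor. 2.13, Cor. 2.5 and Prop. 2.6 (pp. 185–187)]
[cite: PollackRubin2004, Theorem (p. 448) = Thm. 7.3] [cite: Pollack2003, Def. 6.15, Prop. 6.9, 6.10 and 6.18]
[cite: Fisher2012Hessian, §13 (dual pencil, n = 3)] [cite: GreenbergVatsal2000, §2 Prop. (2.4)]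
[cite: Cremona2006, Table 1 (Cremona labels 413600l1, 800a1)] -/
theorem lam4_kobayashiMainConjecture_413600l1_3
    (h12 : Kobayashi2003.thm12_signedSelmerDual_finite_torsion)
    (h41 : Kobayashi2003.thm41_signedCharIdeal_divisibility)
    (h5 : realPeriodRat_eq_unit_mul_plusPeriod) (h3 : realPeriodRat_eq_unit_mul_plusPeriod_three)
    (h09 : cor213_signedMu_eq_zero_iff_of_torsionIso)
    (hKim : BDKim2009.cor213_signedLambda_add_sum_delta_eq_of_torsionIso)
    (hPR : PollackRubin2004.mainTheorem_signedCharIdeal_eq_of_cm)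
    (hmod : nonempty_modularParametrizationData)
    (W A : WeierstrassCurve ℚ) [W.IsElliptic] [W.IsGloballyMinimal] [A.IsElliptic] [A.IsGloballyMinimal]
    [Fact (Nat.Prime 3)] (hW : W = ⟨0, 0, 0, -5900, -4528000⟩) (hA : A = ⟨0, 0, 0, -25, 0⟩)
    (hPollack : ∀ {N : ℕ} [NeZero N] {f : CuspForm (Gamma0 N) 2},
      pollack_exists_plusMinusPAdicLFunction (W := A) (f := f) (p := 3))
    [NeZero (W.conductorNorm ℤ)] {f₀ : CuspForm (Gamma0 (W.conductorNorm ℤ)) 2} (hf₀ : IsNewformOf W f₀)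
    [NeZero (A.conductorNorm ℤ)] {f₀' : CuspForm (Gamma0 (A.conductorNorm ℤ)) 2} (hf₀' : IsNewformOf A f₀')
    (ε : ℤˣ) {Θ Θ' : IwasawaAlgebra 3} (hΘ0 : Θ ≠ 0) (hμ : mu Θ = 0) (hΘ'0 : Θ' ≠ 0) (hμ' : mu Θ' = 0)
    (hrow : (ε = -1 ∧
        iwasawaToPowerSeries 3 Θ = ((mazurTateElement f₀ 3 3).map (algebraMap ℚ ℚ_[3]) : PowerSeries ℚ_[3]) ∧
        lam Θ = (cyclotomicOmegaPlus 3 3).natDegree + 3 ∧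
        iwasawaToPowerSeries 3 Θ' = ((mazurTateElement f₀' 3 1).map (algebraMap ℚ ℚ_[3]) : PowerSeries ℚ_[3]) ∧
        lam Θ' = (cyclotomicOmegaPlus 3 1).natDegree + 1) ∨
      (ε = 1 ∧
        iwasawaToPowerSeries 3 Θ = ((mazurTateElement f₀ 3 2).map (algebraMap ℚ ℚ_[3]) : PowerSeries ℚ_[3]) ∧
        lam Θ = (cyclotomicOmegaMinus 3 2).natDegree + 3 ∧
        iwasawaToPowerSeries 3 Θ' = ((mazurTateElement f₀' 3 2).map (algebraMap ℚ ℚ_[3]) : PowerSeries ℚ_[3]) ∧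
        lam Θ' = (cyclotomicOmegaMinus 3 2).natDegree + 1)) :
    KobayashiMainConjecture W 3 ε := by
  have hI : integralModelInt W = ⟨0, 0, 0, -5900, -4528000⟩ :=
    integralModelInt_eq_of_map_eq _ (by rw [hW]; ext <;> simp [WeierstrassCurve.map])
  have hI' : integralModelInt A = ⟨0, 0, 0, -25, 0⟩ :=
    integralModelInt_eq_of_map_eq _ (by rw [hA]; ext <;> simp [WeierstrassCurve.map])
  have hp2 : (3 : ℕ) ≠ 2 := by decide
  have hSS : GoodSS W 3 := goodSS_of_intModel 3 hI (by decide) card_c413600l1_3 (by norm_num)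
  have hap : W.frobeniusTrace 3 = 0 := by rw [frobeniusTrace_eq hI card_c413600l1_3]; norm_num
  have hSS' : GoodSS A 3 := goodSS_of_intModel 3 hI' (by decide) card_cmm25_0_3 (by norm_num)
  have hap' : A.frobeniusTrace 3 = 0 := by rw [frobeniusTrace_eq hI' card_cmm25_0_3]; norm_num
  have hcm' : A.HasCM := hasCM_cmm25_0 hI'
  -- the 3-congruence `E[3] ≃ A[3]`: dual Hesse pencil of `A` through `E` (Fisher §13), kernel-checked
  have hc4 : W.c₄ = (283200 : ℚ) := by
    subst hW; norm_num [WeierstrassCurve.c₄, WeierstrassCurve.b₂, WeierstrassCurve.b₄]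
  have hc6 : W.c₆ = (3912192000 : ℚ) := by
    subst hW; norm_num [WeierstrassCurve.c₆, WeierstrassCurve.b₂, WeierstrassCurve.b₄, WeierstrassCurve.b₆]
  have hc4A : A.c₄ = (1200 : ℚ) := by
    subst hA; norm_num [WeierstrassCurve.c₄, WeierstrassCurve.b₂, WeierstrassCurve.b₄]
  have hc6A : A.c₆ = (0 : ℚ) := by
    subst hA; norm_num [WeierstrassCurve.c₆, WeierstrassCurve.b₂, WeierstrassCurve.b₄, WeierstrassCurve.b₆]
  have he := threeCongruent_of_dualHesseCertificate_unconditional A W (-80 : ℚ) 1 ((1 : ℚ) / 120)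
    (by norm_num) (by rw [hc4A, hc6A, hc4, eval_hesseD3]; norm_num)
    (by rw [hc4A, hc6A, hc6, eval_hesseC6three]; norm_num)
  obtain ⟨S₀, hS₀, hS₀W, hS₀A, hsumW, hsumA⟩ := places_413600l1_800a1 W A hW hA
  rcases hrow with ⟨rfl, hΘ, hlam, hΘ', hlam'⟩ | ⟨rfl, hΘ, hlam, hΘ', hlam'⟩
  · exact kobayashiMainConjecture_neg_one_of_cmPartner_of_mazurTate h12 h41 h5 h3 h09 hKim hPR hmod hp2 hSS.1
      hap hf₀ (by decide) hΘ hΘ0 hμ hlam hPollack hcm' hSS' hap' he hf₀' (by decide) hΘ' hΘ'0 hμ' hlam' S₀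
      hS₀ hS₀W hS₀A (by rw [hsumW, hsumA])
  · exact kobayashiMainConjecture_one_of_cmPartner_of_mazurTate h12 h41 h5 h3 h09 hKim hPR hmod hp2 hSS.1
      hap hf₀ (by decide) hΘ hΘ0 hμ hlam hPollack hcm' hSS' hap' he hf₀' (by decide) hΘ' hΘ'0 hμ' hlam' S₀
      hS₀ hS₀W hS₀A (by rw [hsumW, hsumA])

/-- **`BSD(E,3)` for `413600l1` (X7, `r_an = 1`, `3Nn`) through the IMAGE-FREE rank-one road**
`bsdp_of_kobayashiMainConjecture_of_corA5_of_analyticRank_eq_one` (Burungale–Kobayashi–Ota 2024 Cor. A.5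
`hA5` — referee flags `BKO24-CorA5-IMC-unpinned`, `BKO24-CorA5-proof-by-reference-Kob14` displayed with
the fact —, modularity `hmod'`, GZK `hGZK`, rank datum `hr`) fed with `lam4_kobayashiMainConjecture_413600l1_3`
(odd rows, `ε = −1`). The tree ALSO has a flag-free exact-descent `BSD(E,3)` for this curve
(`bsdp3_nn413600l1`); what is new here is the SIGNED MAIN CONJECTURE at the pair without preprint and a
second, descent-free road to `BSD(E,3)`. PER PAIR; nothing booked; BSD is not proved by any of this.
[cite: BurungaleKobayashiOta2023, App. A Cor. A.5] [cite: Kobayashi2003, Thm. 7.4 and Conjecture (p. 2)]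
[cite: BDKim2009, Cor. 2.13 (p. 187)] [cite: Miller2011LMS, Def. 1.1] [cite: Cremona2006, Table 1 (Cremona labels 413600l1, 800a1)] -/
theorem lam4_bsdp_413600l1_3
    (h12 : Kobayashi2003.thm12_signedSelmerDual_finite_torsion)
    (h41 : Kobayashi2003.thm41_signedCharIdeal_divisibility)
    (h5 : realPeriodRat_eq_unit_mul_plusPeriod) (h3 : realPeriodRat_eq_unit_mul_plusPeriod_three)
    (h09 : cor213_signedMu_eq_zero_iff_of_torsionIso)
    (hKim : BDKim2009.cor213_signedLambda_add_sum_delta_eq_of_torsionIso)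
    (hPR : PollackRubin2004.mainTheorem_signedCharIdeal_eq_of_cm)
    (hmod : nonempty_modularParametrizationData) (hmod' : hasEntireLFunction_rat)
    (hA5 : corA5_pPart_of_signedCharIdeal_eq) (hGZK : rank_eq_analyticRank_of_analyticRank_le_one)
    (W A : WeierstrassCurve ℚ) [W.IsElliptic] [W.IsGloballyMinimal] [A.IsElliptic] [A.IsGloballyMinimal]
    [Fact (Nat.Prime 3)] (hW : W = ⟨0, 0, 0, -5900, -4528000⟩) (hA : A = ⟨0, 0, 0, -25, 0⟩)
    (hr : W.analyticRank = 1)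
    (hPollack : ∀ {N : ℕ} [NeZero N] {f : CuspForm (Gamma0 N) 2},
      pollack_exists_plusMinusPAdicLFunction (W := A) (f := f) (p := 3))
    [NeZero (W.conductorNorm ℤ)] {f₀ : CuspForm (Gamma0 (W.conductorNorm ℤ)) 2} (hf₀ : IsNewformOf W f₀)
    [NeZero (A.conductorNorm ℤ)] {f₀' : CuspForm (Gamma0 (A.conductorNorm ℤ)) 2} (hf₀' : IsNewformOf A f₀')
    {Θ Θ' : IwasawaAlgebra 3}
    (hΘ : iwasawaToPowerSeries 3 Θ = ((mazurTateElement f₀ 3 3).map (algebraMap ℚ ℚ_[3]) : PowerSeries ℚ_[3]))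
    (hΘ0 : Θ ≠ 0) (hμ : mu Θ = 0) (hlam : lam Θ = (cyclotomicOmegaPlus 3 3).natDegree + 3)
    (hΘ' : iwasawaToPowerSeries 3 Θ' = ((mazurTateElement f₀' 3 1).map (algebraMap ℚ ℚ_[3]) : PowerSeries ℚ_[3]))
    (hΘ'0 : Θ' ≠ 0) (hμ' : mu Θ' = 0) (hlam' : lam Θ' = (cyclotomicOmegaPlus 3 1).natDegree + 1) :
    BSDp W 3 := by
  have hI : integralModelInt W = ⟨0, 0, 0, -5900, -4528000⟩ :=
    integralModelInt_eq_of_map_eq _ (by rw [hW]; ext <;> simp [WeierstrassCurve.map])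
  have hp2 : (3 : ℕ) ≠ 2 := by decide
  have hSS : GoodSS W 3 := goodSS_of_intModel 3 hI (by decide) card_c413600l1_3 (by norm_num)
  have hap : W.frobeniusTrace 3 = 0 := by rw [frobeniusTrace_eq hI card_c413600l1_3]; norm_num
  exact bsdp_of_kobayashiMainConjecture_of_corA5_of_analyticRank_eq_one W 3 hA5 hmod' hGZK hp2 hSS.1 hap hr (-1)
    (lam4_kobayashiMainConjecture_413600l1_3 h12 h41 h5 h3 h09 hKim hPR hmod W A hW hA hPollack hf₀ hf₀' (-1)
      hΘ0 hμ hΘ'0 hμ' (Or.inl ⟨rfl, hΘ, hlam, hΘ', hlam'⟩))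

end Summit.BirchSwinnertonDyer.BirchSwinnertonDyer.Theorems.SmallImageCongruenceRoad

end
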